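import Literature.AlgebraicGeometry.ModuliOfAbelianVarieties.SiegelFineModuliSchemeClassifyCoequalKernelPair
import HarnessLib

/-!
# The classifying map descended through a twist-killed quotient is independent of the refining cover
# ([MFK94] Ch. 7 §3 pp. 139–142; [Lan 2013] Rem. 1.4.1.9)

Topic `AlgebraicGeometry/ModuliOfAbelianVarieties`; namespace
`Literature.AlgebraicGeometry.ModuliOfAbelianVarieties.SiegelFineModuliScheme`.  THEOREMS ONLY (no definition, no named
fact, no instance, no notation, no `sorry`; net Literature debt 0).  Cell hodgecm-mathlib (D-0151), F-DAG leaf F-10 (b)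
«`classify` for the quotient `M/Γ`», brick (b3-lite), over ★ (b2) `SiegelFineModuliSchemeClassifyCoequalKernelPair`
(`existsUnique_desc_classifyingMap_left_comp`: along an fpqc refining cover `c : T′ → T` of a level-`N₀` triple `Y`
the morphism `classifyingMap P′ ≫ p` descends uniquely to `f : T → Q`, for every `p : M → Q` killed by the twist
operators of `K_δ(N₀)`).  Here: the descended `f` does NOT depend on the chosen cover and refinement — two refinements
`(T₁, P₁)`, `(T₂, P₂)` of the same `Y` give the same `f`, because on the common refinement `T₁ ×_T T₂` the two pulled
back refinements have `p`-equal classifying maps (★ §1 `classifyingMap_left_comp_eq_of_changeLevel_isBaseChangeVia`)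
and `T₁ ×_T T₂ → T` is an epimorphism of schemes (surjective + flat + quasi-compact ⇒ effective epimorphism, Mathlib;
[GortzWedhorn2020] Thm. 14.72).  This is the well-definedness half of [MumfordFogartyKirwan1994] Ch. 7 §3's
«`A_{g,d,n}/Γ` represents the level-`n₀` functor» (pp. 139–142) / [Lan2013PELCompactifications] Rem. 1.4.1.9.
HC_CM is proved only modulo the 7 printed citations until rung 0 closes; this file discharges none of them
(count-neutral capital).

* **`desc_classifyingMap_left_comp_independent`** — `c₁ ≫ f₁ = classifyingMap P₁ ≫ p`, `c₂ ≫ f₂ = classifyingMap P₂ ≫ p`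
  ⇒ `f₁ = f₂`.
* `eq_desc_classifyingMap_left_comp_of_lift` (ed. 2) — LIFTED FORM: if `f : T → Q` lifts over an fpqc cover `c : T′ → T`
  to `f̃ : T′ → M` with `(f̃^* 𝒰).changeLevel N₀` the pull-back of `Y`, then `f` equals the descended map of every
  refinement of `Y` (`f̃ = classifyingMap (f̃^* 𝒰)` by ★ `classifyingMap_comp` / `classifyingMap_self`).

Mathlib searched (pin): `cancel_epi`, the instances `EffectiveEpi` ⇐ surjective + flat + quasi-compact and their
stability under composition / base change, `LocallyOfFiniteType.isLocallyNoetherian` (all used).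

## References
* D. Mumford, J. Fogarty, F. Kirwan, *Geometric Invariant Theory*, 3rd ed. (1994), Ch. 7 §3 (pp. 139–140; pp. 140–142).
  [MumfordFogartyKirwan1994]
* K.-W. Lan, *Arithmetic compactifications of PEL-type Shimura varieties* (2013), §1.4.1 Remark 1.4.1.9 (p. 90).
  [Lan2013PELCompactifications]
* U. Görtz, T. Wedhorn, *Algebraic Geometry I*, 2nd ed. (2020), Thm. 14.72. [GortzWedhorn2020]
-/

noncomputable section

open CategoryTheory CategoryTheory.Limits AlgebraicGeometry
open scoped MonObj

namespace Literature.AlgebraicGeometry.ModuliOfAbelianVarieties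

open Literature.AlgebraicGeometry.Motives (SchemeOver)
open Literature.AlgebraicGeometry.AbelianSchemes (PolarizedAbelianSchemeWithLevel)
open Literature.AlgebraicGeometry.AbelianSchemes.AbelianSchemeOver
open Literature.NumberTheory.Adeles NumberField IsDedekindDomain

namespace SiegelFineModuliScheme

variable {g N : ℕ} {δ : Fin g → ℕ} (𝓜 : SiegelFineModuliScheme g N δ) [IsCommMonObj 𝓜.univ.A.X] [NeZero N]

/-- **THE DESCENDED CLASSIFYING MAP DOES NOT DEPEND ON THE REFINEMENT** ([MumfordFogartyKirwan1994] Ch. 7 §3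
pp. 139–142; [Lan2013PELCompactifications] Rem. 1.4.1.9): if a level-`N₀` triple `Y` over `T` is refined to level `N`
over two fpqc covers `c₁ : T₁ → T`, `c₂ : T₂ → T` (`P₁` over `T₁`, `P₂` over `T₂`, level-`N₀` reductions the
pull-backs of `Y`), and `fᵢ : T → Q` satisfies `cᵢ ≫ fᵢ = classifyingMap Pᵢ ≫ p` for a morphism `p : M → Q` killed by the
twist operators of `K_δ(N₀)`, then `f₁ = f₂`: on `T₁ ×_T T₂` the two pulled-back refinements have `p`-equal classifying
maps (★ `classifyingMap_left_comp_eq_of_changeLevel_isBaseChangeVia`), and `T₁ ×_T T₂ → T` is an epimorphism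
(surjective + flat + quasi-compact ⇒ effective epimorphism, Mathlib). [cite: MumfordFogartyKirwan1994, Ch. 7 §3 (pp. 139–140)]
[cite: Lan2013PELCompactifications, §1.4.1 Remark 1.4.1.9 (p. 90)] [cite: GortzWedhorn2020, Thm. 14.72] -/
theorem desc_classifyingMap_left_comp_independent (hδ : IsPolarizationType δ) (hg : 0 < g)
    {N₀ d : ℕ} [NeZero N₀] (hd : N = N₀ * d) {T T₁ T₂ : SchemeOver ℚ} [IsLocallyNoetherian T₂.left]
    (c₁ : T₁ ⟶ T) (c₂ : T₂ ⟶ T) [Surjective c₁.left] [Flat c₁.left] [QuasiCompact c₁.left]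
    [LocallyOfFiniteType c₁.left] [Surjective c₂.left] [Flat c₂.left] [QuasiCompact c₂.left]
    [IsLocallyNoetherian T₁.left]
    (P₁ : PolarizedAbelianSchemeWithLevel g N δ T₁.left) [IsCommMonObj P₁.A.X]
    (P₂ : PolarizedAbelianSchemeWithLevel g N δ T₂.left)
    {Y : PolarizedAbelianSchemeWithLevel g N₀ δ T.left}
    {G₁ : P₁.A.X.left ⟶ Y.A.X.left} {Ĝ₁ : P₁.D.hat.X.left ⟶ Y.D.hat.X.left}
    {G₂ : P₂.A.X.left ⟶ Y.A.X.left} {Ĝ₂ : P₂.D.hat.X.left ⟶ Y.D.hat.X.left}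
    (hY₁ : (P₁.changeLevel N₀ d hd (NeZero.ne N)).IsBaseChangeVia Y c₁.left G₁ Ĝ₁)
    (hY₂ : (P₂.changeLevel N₀ d hd (NeZero.ne N)).IsBaseChangeVia Y c₂.left G₂ Ĝ₂)
    {Q : Scheme} (p : 𝓜.M.left ⟶ Q)
    (hp : ∀ r : gspFinAdelic δ, r ∈ principalLevelSubgroup δ N₀ → ∀ GN : GL (Fin g ⊕ Fin g) (ZMod N),
      (∀ (i j : Fin g ⊕ Fin g)
        (h : ((r : GL (Fin g ⊕ Fin g) finAdeleQ) : Matrix (Fin g ⊕ Fin g) (Fin g ⊕ Fin g) finAdeleQ) i j ∈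
          FiniteAdeleRing.integralAdeles (𝓞 ℚ) ℚ),
        (GN : Matrix (Fin g ⊕ Fin g) (Fin g ⊕ Fin g) (ZMod N)) i j = integralAdeleResidue N ⟨_, h⟩) →
      ∀ hs : (𝓜.univ.level.twist GN).IsSymplecticLiftable 𝓜.univ.pol δ,
        (haveI := 𝓜.isLocallyNoetherian
         (𝓜.classifyingMap 𝓜.M ({ 𝓜.univ with level := 𝓜.univ.level.twist GN, symplectic := hs } :
           PolarizedAbelianSchemeWithLevel g N δ 𝓜.M.left)).left) ≫ p = p)
    (f₁ f₂ : T.left ⟶ Q) (hf₁ : c₁.left ≫ f₁ = (𝓜.classifyingMap T₁ P₁).left ≫ p)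
    (hf₂ : c₂.left ≫ f₂ = (𝓜.classifyingMap T₂ P₂).left ≫ p) : f₁ = f₂ := by
  -- the common refinement `K = T₁ ×_T T₂`, locally Noetherian over `T₂`
  let K : Scheme := pullback c₁.left c₂.left
  haveI : IsLocallyNoetherian K := LocallyOfFiniteType.isLocallyNoetherian (pullback.snd c₁.left c₂.left)
  let Kℚ : SchemeOver ℚ := Over.mk (pullback.fst c₁.left c₂.left ≫ T₁.hom)
  haveI : IsLocallyNoetherian Kℚ.left := inferInstanceAs (IsLocallyNoetherian K)
  let x₁ : Kℚ ⟶ T₁ := Over.homMk (pullback.fst c₁.left c₂.left) rfl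
  let x₂ : Kℚ ⟶ T₂ := Over.homMk (pullback.snd c₁.left c₂.left) (by
    change pullback.snd c₁.left c₂.left ≫ T₂.hom = pullback.fst c₁.left c₂.left ≫ T₁.hom
    rw [← Over.w c₂, ← Category.assoc, ← pullback.condition, Category.assoc, Over.w c₁])
  -- the two pulled-back refinements over `K`
  let P₁' : PolarizedAbelianSchemeWithLevel g N δ Kℚ.left := P₁.baseChange x₁.left
  let P₂' : PolarizedAbelianSchemeWithLevel g N δ Kℚ.left := P₂.baseChange x₂.left
  haveI : IsCommMonObj P₁'.A.X :=
    ⟨(Functor.isCommMonObj_obj (F := Over.pullback x₁.left) (M := P₁.A.X)).mul_comm⟩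
  have w₁ := P₁.baseChange_isBaseChangeVia x₁.left
  have w₂ := P₂.baseChange_isBaseChangeVia x₂.left
  have h₁ := (w₁.changeLevel N₀ d hd (NeZero.ne N)).trans hY₁
  have h₂ := (w₂.changeLevel N₀ d hd (NeZero.ne N)).trans hY₂
  have hx : x₂.left ≫ c₂.left = x₁.left ≫ c₁.left := pullback.condition.symm
  rw [hx] at h₂
  have hK := 𝓜.classifyingMap_left_comp_eq_of_changeLevel_isBaseChangeVia hδ hg hd Kℚ P₁' P₂' h₁ h₂ p hp
  rw [← 𝓜.classifyingMap_comp x₁ P₁ P₁' w₁, ← 𝓜.classifyingMap_comp x₂ P₂ P₂' w₂] at hK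
  simp only [Over.comp_left, Category.assoc] at hK
  -- `hK : fst ≫ cm₁ ≫ p = snd ≫ cm₂ ≫ p`; rewrite through `f₁`, `f₂`
  have hK' : (pullback.fst c₁.left c₂.left ≫ c₁.left) ≫ f₁ = (pullback.fst c₁.left c₂.left ≫ c₁.left) ≫ f₂ :=
    calc (pullback.fst c₁.left c₂.left ≫ c₁.left) ≫ f₁
        = pullback.fst c₁.left c₂.left ≫ (𝓜.classifyingMap T₁ P₁).left ≫ p := by rw [Category.assoc, hf₁]
      _ = pullback.snd c₁.left c₂.left ≫ (𝓜.classifyingMap T₂ P₂).left ≫ p := hK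
      _ = pullback.snd c₁.left c₂.left ≫ c₂.left ≫ f₂ := by rw [hf₂]
      _ = (pullback.fst c₁.left c₂.left ≫ c₁.left) ≫ f₂ := by rw [← Category.assoc, ← pullback.condition]
  -- `fst ≫ c₁` is an fpqc cover of `T`, hence an epimorphism
  haveI : EffectiveEpi (pullback.fst c₁.left c₂.left ≫ c₁.left) := inferInstance
  exact (cancel_epi (pullback.fst c₁.left c₂.left ≫ c₁.left)).1 hK'

/-- **UNIQUENESS OF THE DESCENDED CLASSIFYING MAP, LIFTED FORM** ([MumfordFogartyKirwan1994] Ch. 7 §3 pp. 139–142):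
if `f : T → Q` LIFTS over an fpqc cover `c : T′ → T` to `f̃ : T′ → M` (`c ≫ f = f̃ ≫ p`) in such a way that the
level-`N₀` reduction of `f̃^* 𝒰` (the universal triple pulled back) is the pull-back of `Y` along `c`, then `f` IS the
descended classifying map of every refinement `(T₁, c₁, P₁)` of `Y`: `f̃ = classifyingMap (f̃^* 𝒰)` (★ `classifyingMap_comp`,
`classifyingMap_self`), so `(T′, f̃^* 𝒰)` is itself a refinement of `Y` with descended map `f`, and
`desc_classifyingMap_left_comp_independent` applies.  (For `Q = M/Γ` the consumer takes `T′ = T ×_Q M`, `f̃ = pr₂`, and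
gets the reduction clause from `Y ≅ f^* X_Q`, `X ≅ p^* X_Q` by the cancellation ★ `PolarizedAbelianSchemeWithLevelBaseChangeCancel`.)
[cite: MumfordFogartyKirwan1994, Ch. 7 §3 (pp. 139–140)] [cite: Lan2013PELCompactifications, §1.4.1 Remark 1.4.1.9 (p. 90)] -/
theorem eq_desc_classifyingMap_left_comp_of_lift (hδ : IsPolarizationType δ) (hg : 0 < g)
    {N₀ d : ℕ} [NeZero N₀] (hd : N = N₀ * d) {T T' T₁ : SchemeOver ℚ} [IsLocallyNoetherian T'.left]
    [IsLocallyNoetherian T₁.left] (c : T' ⟶ T) [Surjective c.left] [Flat c.left] [QuasiCompact c.left]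
    [LocallyOfFiniteType c.left] (c₁ : T₁ ⟶ T) [Surjective c₁.left] [Flat c₁.left] [QuasiCompact c₁.left]
    {Y : PolarizedAbelianSchemeWithLevel g N₀ δ T.left} (ft : T' ⟶ 𝓜.M)
    {G : (𝓜.univ.baseChange ft.left).A.X.left ⟶ Y.A.X.left}
    {Ĝ : (𝓜.univ.baseChange ft.left).D.hat.X.left ⟶ Y.D.hat.X.left}
    (hlift : ((𝓜.univ.baseChange ft.left).changeLevel N₀ d hd (NeZero.ne N)).IsBaseChangeVia Y c.left G Ĝ)
    (P₁ : PolarizedAbelianSchemeWithLevel g N δ T₁.left)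
    {G₁ : P₁.A.X.left ⟶ Y.A.X.left} {Ĝ₁ : P₁.D.hat.X.left ⟶ Y.D.hat.X.left}
    (hY₁ : (P₁.changeLevel N₀ d hd (NeZero.ne N)).IsBaseChangeVia Y c₁.left G₁ Ĝ₁)
    {Q : Scheme} (p : 𝓜.M.left ⟶ Q)
    (hp : ∀ r : gspFinAdelic δ, r ∈ principalLevelSubgroup δ N₀ → ∀ GN : GL (Fin g ⊕ Fin g) (ZMod N),
      (∀ (i j : Fin g ⊕ Fin g)
        (h : ((r : GL (Fin g ⊕ Fin g) finAdeleQ) : Matrix (Fin g ⊕ Fin g) (Fin g ⊕ Fin g) finAdeleQ) i j ∈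
          FiniteAdeleRing.integralAdeles (𝓞 ℚ) ℚ),
        (GN : Matrix (Fin g ⊕ Fin g) (Fin g ⊕ Fin g) (ZMod N)) i j = integralAdeleResidue N ⟨_, h⟩) →
      ∀ hs : (𝓜.univ.level.twist GN).IsSymplecticLiftable 𝓜.univ.pol δ,
        (haveI := 𝓜.isLocallyNoetherian
         (𝓜.classifyingMap 𝓜.M ({ 𝓜.univ with level := 𝓜.univ.level.twist GN, symplectic := hs } :
           PolarizedAbelianSchemeWithLevel g N δ 𝓜.M.left)).left) ≫ p = p)
    (f f₁ : T.left ⟶ Q) (hf : c.left ≫ f = ft.left ≫ p)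
    (hf₁ : c₁.left ≫ f₁ = (𝓜.classifyingMap T₁ P₁).left ≫ p) : f = f₁ := by
  haveI := 𝓜.isLocallyNoetherian
  haveI : IsCommMonObj (𝓜.univ.baseChange ft.left).A.X :=
    ⟨(Functor.isCommMonObj_obj (F := Over.pullback ft.left) (M := 𝓜.univ.A.X)).mul_comm⟩
  -- `f̃` classifies `f̃^* 𝒰`
  have hcm : 𝓜.classifyingMap T' (𝓜.univ.baseChange ft.left) = ft := by
    have h := 𝓜.classifyingMap_comp ft 𝓜.univ (𝓜.univ.baseChange ft.left) (𝓜.univ.baseChange_isBaseChangeVia ft.left)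
    rw [𝓜.classifyingMap_self, Category.comp_id] at h
    exact h.symm
  have hf' : c.left ≫ f = (𝓜.classifyingMap T' (𝓜.univ.baseChange ft.left)).left ≫ p := by rw [hcm]; exact hf
  exact 𝓜.desc_classifyingMap_left_comp_independent hδ hg hd c c₁ _ P₁ hlift hY₁ p hp f f₁ hf' hf₁


end SiegelFineModuliScheme

end Literature.AlgebraicGeometry.ModuliOfAbelianVarieties

end
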